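import Summits.KontsevichZagierPeriods.KontsevichZagierPeriods.Theses.TorsionLogs
import Summits.KontsevichZagierPeriods.KontsevichZagierPeriods.Theorems.TorsionLogsNeronTorsionSector
import Literature.NumberTheory.Transcendental.KZKernelConjectureForms
import Literature.NumberTheory.Transcendental.KZLogCalculusProofs

/-!
# Line `NeronTorsionGenusTwo` — crux `TorsionSectorComplete` (stmt-KontsevichZagierPeriods-14212),
# route `route-KontsevichZagierPeriods-TorsionLogs`; forward generator G1 `next-rung`, gen 14

FLOOR (proved, stmt-KontsevichZagierPeriods-17981): the route decl `Theses.TorsionLogs.NeronTorsionPrimitiveChain`, closed by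
`Cruxes.NeronTorsionSector.Translation.stub_assembly` (alias `NeronTorsionPrimitiveChain_holds`): for a real cubic
`y² = f(x) = 4x³ − g₂x − g₃` and a real `N`-torsion POINT `P` on the unbounded branch, the Néron/torsion element
`q²•[rI] + p²•[rP] − c•[1<t<B, dt/t]` lies in `KZ.relations` — GENUS ONE: the curve is its own Jacobian, torsion
translations act on the curve, and the floor's move chain is the translation calculus `x(u + u_P)` of ONE cubic.

THE ONE MOVE (dimension/genus lift `g = 1 ↦ g = 2`, in the Statement's direction): replace the cubic by a real GENUS-TWO
`M`-curve `y² = f(x) = 4x⁵ + λ₄x⁴ + λ₃x³ + λ₂x² + λ₁x + λ₀ = 4∏(x − eᵢ)`, `e₁ > … > e₅`, the torsion point by a real torsion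
PAIR `{P₁, P₂}` (`P₁ = (x₁, ε√f(x₁))`, `x₁ > e₁`; `P₂ = (x₂, √f(x₂))`, `e₃ < x₂ < e₂`) — i.e. a torsion point
`v = u(P₁) + u(P₂)` of the JACOBIAN relative to the 2-torsion point `h′ = u(E₁) + u(E₃)` — and the Weierstrass `℘/ζ/σ`
by Klein's genus-two `℘_{ij}/ζᵢ/σ` (Baker 1907; Buchstaber–Enolskiĭ–Leĭkin 1997, §2).  The floor's single iterated
triangle `[rI]` becomes TWO Baker triangles + one CROSS rectangle + one third-kind EXCHANGE integral, and the floor's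
quasi-period quadrant `[rP]` (value `η₁ω₁/2`) becomes the `2 × 2` matrix of PERIOD RECTANGLES `R_ab` (values
`(2∮_{a_a}du)ᵀ(2∮_{a_b}dr)`):

  `8M²•([rI₁] + [rI₂] + [rX] − [rJ]) − Σ_{a,b} n_a n_b•[R_ab] − c•[1<t<B, dt/t] ∈ KZ.relations`,

with the BAKER KERNEL `𝔎(z) = (ρ₁(z₁) + ρ₂(z₁)z₀)/(√f(z₁)√f(z₀))`, `ρ₁ = (12x³ + 2λ₄x² + λ₃x)/4`, `ρ₂ = x²`
(`𝔎 dz₁dz₀ = Σₖ drₖ(z₁)duₖ(z₀)`, `du = (1, x)dx/y`, `dr = (ρ₁, ρ₂)dx/y`), `rI₁ = [e₁<z₁<z₀<x₁, 𝔎]`, `rI₂ = [e₃<z₁<z₀<x₂, 𝔎]`,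
`rX = [z₁∈(e₁,x₁), z₀∈(e₃,x₂), ε𝔎]`, `rJ = [e₃<t<x₂, (ε√f(x₁) − √f(t))/(2(x₁−t)√f(t))]`, `R_ab = [z₀∈a_a, z₁∈a_b, 4𝔎]`
(`a₁ = (e₅,e₄)`, `a₂ = (e₃,e₂)` the compact ovals' shadows), and the TORSION TIE `2M·t = n₁(2∮_{a₁}du) + n₂(2∮_{a₂}du)` for the
real displacement `t = ε∫_{e₁}^{x₁}du + ∫_{e₃}^{x₂}du ≡ v − h′` (both components), `n = (n₁, n₂) ∈ ℤ²`.

VALUE LEVEL (the Néron–Riemann identity behind it, derived in the seat folder `NOTES.md ## Derivation` and CHECKED NUMERICALLY):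
with `λ(u) = −log|θ[δ]((2ω)⁻¹u)| + π·Im((2ω)⁻¹u)ᵀ(Im τ)⁻¹Im((2ω)⁻¹u)` the (normalised) Néron function of `Θ = W₁` on `Jac`,
  `I₁ + I₂ + εX − J − ½log((x₁−e₃)/(e₁−e₃)) − ½ sᵀ𝕄s = λ(u(P₁)+u(P₂)) − λ(u(E₁)+u(E₃))`,   `s := Ω_A⁻¹t`, `𝕄_{ab} := value(R_ab)`,
uniformly in `ε = ±1` (numerics: generic pairs on `e = (2,1,0,−1,−3)` — four pairs with `ε = +1`, |defect| ≤ 4.3e-13; two with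
`ε = −1`, ≤ 3.8e-13).
At a torsion pair (`2Ms = n`) the right side is a difference of Néron values at torsion points of `Jac`, i.e. `(1/8M²)·log` of a
real algebraic number (Néron functions are quadratic-plus-`log|algebraic|` on torsion, [cite: Lang1983, Ch. 11 Thm 1.1, Ch. 13];
for 2-torsion `exp(8λ({Eᵢ,Eⱼ})) = ∏_{k∉{i,j}}|(eᵢ−e_k)(eⱼ−e_k)|²`-type Thomae values), whence the element above with
`c·log B := 8M²(λ(v) − λ(h′)) + 4M²log((x₁−e₃)/(e₁−e₃))`.
TORSION CERTIFICATE (seat folder `num/checkC.py`, pure double precision): on `C₄ : y² = 4(x−2)(x+2)(x³+4x²−7x−1)`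
(roots `2, 1.42107, −0.13307, −2, −5.28799`) the pair `P₁ = (5, −126)` [`ε = −1`], `P₂ = (0, 4)` is 4-torsion relative to `h′`:
`φ = ¼x²(x−5)² + (x+¼)²(8x−16) + (x+¼)·y` has `φ·φ̄ = (1/16)(x(x−5))⁴`, so `div φ = 4P₁ + 4P₂ − 8∞` (`M = 2`, `n = (1,−1)`;
tie defects 7e-14, 4e-13); `exp(8λ(v))·|normalisation| = 1524096.000005 ≈ 2⁷·3⁵·7²`; and
`8M²(I₁+I₂+εX−J) − nᵀ𝕄n = 106.995684386721` against `8M²(λ(v)−λ(h′)) + 4M²log((x₁−e₃)/(e₁−e₃)) = 106.995684386718` (3.2e-12).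
Thomae check on `e = (2,1,0,−1,−3)`: `exp(8λ({Eᵢ,Eⱼ}))` = `240², 45², 40², 144², 48², 24², 60², 72², 80², 360²` (to 1e-9).

HONEST CONTAINMENT.  Member `true` does not literally specialise to the floor (a quintic is not a cubic); at the nodal stratum
`e₅ → e₄` it degenerates to a genus-ONE two-point statement of the type of the filed lines `NeronTorsionTwoPoint` /
`NeronTorsionCoset`, not to the floor.  Hence the two-member device (as in `Lines/NeronIsogeny.lean`): member `false` is the
floor VERBATIM (the seed theorem IS that member), member `true` the genus-two statement; the rung is both.

WHY ONE MOVE UP NEEDS A NEW IDEA (where the floor's proof stops): the floor's chain (`Theorems/TorsionLogsNeronTorsionSector*.lean`,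
`stub_hChain`/`stub_innerNL`) substitutes `x(u + u_P)` — translation by the torsion point IS an algebraic self-map of the
curve.  In genus two, translation by a torsion point of `Jac` does not act on the curve (only on `Sym² C`), so there is no
one-variable algebraic substitution to feed rule 2; the replacement is the ABEL–JACOBI CERTIFICATE `φ = P(x) + Q(x)y` with
`div φ = 2M(P₁ + P₂) − 4M∞` (stub A) and a chain through its logarithmic differential and Baker's third-kind kernel
`(y + y₁)/(2(x − x₁)y)` (stub B) — the genus-two division polynomials `ψₙ` (Kanayama 2005, Uchida 2011) in place of the
floor's `ψ_N`.

FAMILY: `NeronTorsionGenusTwoMember : Bool → Prop`, `false ↦` the floor decl VERBATIM (genus 1), `true ↦ GenusTwoNeronSector`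
(genus 2); THE RUNG `NeronTorsionGenusTwo := ∀ b, NeronTorsionGenusTwoMember b`.

SKELETON (3 registered stubs → the crux BY NAME):
* `stub_abelJacobiPairCertificate : AbelJacobiPairCertificate` (L/XL, classical) — tie ⇒ certificate `φ = P + Qy`.
* `stub_genusTwoPairChain : GenusTwoPairChain` (XL, THE REAL STEP) — tie + certificate + pinned cells ⇒ the primitive chain
  `8M²•(…) − Σ n_a n_b•[R_ab] − c•[rB] ∈ relations` for some integer `c` and real algebraic `B > 1`.
* `stub_genusTwoSectorComplete : GenusTwoSectorComplete` (residual, conjecture-grade) — completeness modulo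
  `relations ⊔ closure (T ∪ T₂)`; WEAKER than the crux (`genusTwoSectorComplete_of_torsionSectorComplete`).
Proved here (no `sorry`): the primitive chain from A + B, the tied member from it (soundness + the landed log calculus
`interval_log_relation_mem_relations`), the rung, `closure T₂ ≤ relations`, `closure T ≤ relations`, the F4 on-path theorem
`KontsevichZagierPeriods → NeronTorsionGenusTwo`, the F3 specialisation `NeronTorsionGenusTwo → floor` (by name and as the
floor's verbatim type), and `TorsionSectorComplete_of`.
-/

noncomputable section

open Set MeasureTheory Filter Topology
open Literature.NumberTheory.Transcendental Literature.ModelTheory.ExponentialFields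
open Summit.KontsevichZagierPeriods.KontsevichZagierPeriods.Theses.TorsionLogs (NeronTorsionSector NeronTorsionPrimitiveChain
  NeronTorsionPrimitiveChain_holds TorsionSectorComplete)
open Summit.KontsevichZagierPeriods.KontsevichZagierPeriods.Cruxes.NeronTorsionSector.Translation (NeronTorsionSector_of
  logRep_value isAlgebraic_of_logRep)
open Summit.KontsevichZagierPeriods.HyperbolicBloch.OffTetraSectorKernel (interval_log_relation_mem_relations)

-- `Summit.KontsevichZagierPeriods.KontsevichZagierPeriods.…` is the tree's mandated layout (single-conjunct summit).
set_option linter.dupNamespace false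

namespace Summit.KontsevichZagierPeriods.KontsevichZagierPeriods.Cruxes.TorsionSectorComplete.NeronTorsionGenusTwo

/-! ### Statements -/

/-- The **Baker kernel** of the genus-2 curve `y² = f(x) = 4x⁵ + λ₄x⁴ + λ₃x³ + λ₂x² + λ₁x + λ₀`:
`𝔎(z) = (ρ₁(z₁) + ρ₂(z₁)·z₀) / (√f(z₁) √f(z₀))` with `ρ₁(x) = (12x³ + 2λ₄x² + λ₃x)/4`, `ρ₂(x) = x²` — the numerators of
the second-kind differentials `drₖ = ρₖ dx/y` dual to `du₁ = dx/y`, `du₂ = x dx/y` (Baker 1907; Buchstaber–Enolskii–Leykin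
1997, §2), paired against `du₁, du₂` in the variable `z₀`: `𝔎 dz₁ dz₀ = Σₖ drₖ(z₁) duₖ(z₀)`.
[cite: KontsevichZagier2001, §1.2] -/
def bakerKernel (f : ℝ → ℝ) (l₄ l₃ : ℝ) (z : Fin 2 → ℝ) : ℝ :=
  ((12 * z 1 ^ 3 + 2 * l₄ * z 1 ^ 2 + l₃ * z 1) / 4 + z 1 ^ 2 * z 0) / (Real.sqrt (f (z 1)) * Real.sqrt (f (z 0)))

/-- **Member `true`: the TIED GENUS-TWO NÉRON SECTOR STATEMENT.**  Data: a real genus-2 `M`-curve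
`y² = f(x) = 4x⁵ + λ₄x⁴ + … + λ₀ = 4(x−e₁)(x−e₂)(x−e₃)(x−e₄)(x−e₅)`, `e₁ > e₂ > e₃ > e₄ > e₅`; a real PAIR of points
`P₁ = (x₁, ε√f(x₁))` on the infinite branch (`x₁ > e₁`, `ε = ±1`) and `P₂ = (x₂, +√f(x₂))` on the oval over `(e₃, e₂)`;
the TORSION TIE: the real Abel–Jacobi displacement of the divisor class `[P₁ + P₂ − E₁ − E₃]`, times `2M`, is the
integer combination `n₁·a₁ + n₂·a₂` of the two real periods (ovals `a₁ = (e₅,e₄)`, `a₂ = (e₃,e₂)`), for BOTH holomorphic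
differentials `dx/y`, `x dx/y` (so the class is torsion of order dividing `4M` on the Jacobian; no group law is used to
say so).  Representations pinned as: `rI₁`, `rI₂` = the iterated Baker triangles `e₁ < z₁ < z₀ < x₁`, `e₃ < z₁ < z₀ < x₂`
of `𝔎`; `rX` = the cross rectangle `z₁ ∈ (e₁,x₁), z₀ ∈ (e₃,x₂)` of `ε𝔎`; `rJ` = the third-kind exchange integral
`∫_{e₃}^{x₂} (ε√f(x₁) − √f(t)) dt / (2(x₁ − t)√f(t))`; `R_ab` = the four period rectangles `z₀ ∈ a_a, z₁ ∈ a_b` of `4𝔎`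
(values `(2∮_{a_a} du)ᵀ(2∮_{a_b} dr)`); `rB = [1<t<B, dt/t]`.  The VALUE HYPOTHESIS
`8M²(I₁ + I₂ + X − J) − Σ_{a,b} n_a n_b 𝕄_{ab} = c·log B` gives the element
`8M²•([rI₁]+[rI₂]+[rX]−[rJ]) − Σ n_a n_b•[R_ab] − c•[rB] ∈ KZ.relations`.
(Value level — Néron/Riemann: the left side is `8M²(λ_Θ(P₁+P₂) − λ_Θ(E₁+E₃)) + 4M² log((x₁−e₃)/(e₁−e₃))`, `λ_Θ = −log|σ| + ½Re(uᵀηω⁻¹u)`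
the Néron function of the theta divisor of `Jac`, whose values at torsion points are `(1/8)log|ψ₃|`-type logarithms of
algebraic numbers.) [cite: KontsevichZagier2001, §1.2] [cite: Lang1983, Ch. 11 Thm 1.1, Ch. 13] -/
def GenusTwoNeronSector : Prop :=
  ∀ (e₁ e₂ e₃ e₄ e₅ l₄ l₃ l₂ l₁ l₀ x₁ x₂ ε B : ℝ) (M : ℕ) (n₁ n₂ c : ℤ) (f : ℝ → ℝ),
    (∀ x, f x = 4 * x ^ 5 + l₄ * x ^ 4 + l₃ * x ^ 3 + l₂ * x ^ 2 + l₁ * x + l₀) →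
    (∀ x, f x = 4 * (x - e₁) * (x - e₂) * (x - e₃) * (x - e₄) * (x - e₅)) →
    e₅ < e₄ → e₄ < e₃ → e₃ < e₂ → e₂ < e₁ → e₁ < x₁ → (ε = 1 ∨ ε = -1) → e₃ < x₂ → x₂ < e₂ → 0 < M →
    2 * (M : ℝ) * (ε * (∫ x in Set.Ioo e₁ x₁, (Real.sqrt (f x))⁻¹) + ∫ x in Set.Ioo e₃ x₂, (Real.sqrt (f x))⁻¹) =
      n₁ * (2 * ∫ x in Set.Ioo e₅ e₄, (Real.sqrt (f x))⁻¹) + n₂ * (2 * ∫ x in Set.Ioo e₃ e₂, (Real.sqrt (f x))⁻¹) →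
    2 * (M : ℝ) * (ε * (∫ x in Set.Ioo e₁ x₁, x / Real.sqrt (f x)) + ∫ x in Set.Ioo e₃ x₂, x / Real.sqrt (f x)) =
      n₁ * (2 * ∫ x in Set.Ioo e₅ e₄, x / Real.sqrt (f x)) + n₂ * (2 * ∫ x in Set.Ioo e₃ e₂, x / Real.sqrt (f x)) →
    1 < B →
    ∀ (rI₁ rI₂ rX R₁₁ R₁₂ R₂₁ R₂₂ : KZ.IntegralRep 2) (rJ rB : KZ.IntegralRep 1),
    rI₁.domain = {z | e₁ < z 1 ∧ z 1 < z 0 ∧ z 0 < x₁} → Set.EqOn rI₁.integrand (bakerKernel f l₄ l₃) rI₁.domain →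
    rI₂.domain = {z | e₃ < z 1 ∧ z 1 < z 0 ∧ z 0 < x₂} → Set.EqOn rI₂.integrand (bakerKernel f l₄ l₃) rI₂.domain →
    rX.domain = {z | e₁ < z 1 ∧ z 1 < x₁ ∧ e₃ < z 0 ∧ z 0 < x₂} →
    Set.EqOn rX.integrand (fun z => ε * bakerKernel f l₄ l₃ z) rX.domain →
    rJ.domain = {t | e₃ < t 0 ∧ t 0 < x₂} →
    Set.EqOn rJ.integrand
      (fun t => (ε * Real.sqrt (f x₁) - Real.sqrt (f (t 0))) / (2 * (x₁ - t 0) * Real.sqrt (f (t 0)))) rJ.domain →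
    R₁₁.domain = {z | e₅ < z 0 ∧ z 0 < e₄ ∧ e₅ < z 1 ∧ z 1 < e₄} →
    Set.EqOn R₁₁.integrand (fun z => 4 * bakerKernel f l₄ l₃ z) R₁₁.domain →
    R₁₂.domain = {z | e₅ < z 0 ∧ z 0 < e₄ ∧ e₃ < z 1 ∧ z 1 < e₂} →
    Set.EqOn R₁₂.integrand (fun z => 4 * bakerKernel f l₄ l₃ z) R₁₂.domain →
    R₂₁.domain = {z | e₃ < z 0 ∧ z 0 < e₂ ∧ e₅ < z 1 ∧ z 1 < e₄} →
    Set.EqOn R₂₁.integrand (fun z => 4 * bakerKernel f l₄ l₃ z) R₂₁.domain →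
    R₂₂.domain = {z | e₃ < z 0 ∧ z 0 < e₂ ∧ e₃ < z 1 ∧ z 1 < e₂} →
    Set.EqOn R₂₂.integrand (fun z => 4 * bakerKernel f l₄ l₃ z) R₂₂.domain →
    rB.domain = {t | 1 < t 0 ∧ t 0 < B} → Set.EqOn rB.integrand (fun t => (t 0)⁻¹) rB.domain →
    8 * (M : ℝ) ^ 2 * (rI₁.value + rI₂.value + rX.value - rJ.value) -
        ((n₁ : ℝ) ^ 2 * R₁₁.value + n₁ * n₂ * R₁₂.value + n₂ * n₁ * R₂₁.value + (n₂ : ℝ) ^ 2 * R₂₂.value) =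
      c * rB.value →
    (8 * (M : ℤ) ^ 2) • (KZ.of rI₁ + KZ.of rI₂ + KZ.of rX - KZ.of rJ) -
        ((n₁ ^ 2) • KZ.of R₁₁ + (n₁ * n₂) • KZ.of R₁₂ + (n₂ * n₁) • KZ.of R₂₁ + (n₂ ^ 2) • KZ.of R₂₂) -
      c • KZ.of rB ∈ KZ.relations

/-- **The member family of the rung, indexed by `Bool`** (genus `1 + two.toNat`): member `false` is the FLOOR VERBATIM —
the route decl `Theses.TorsionLogs.NeronTorsionPrimitiveChain` (genus 1: one real torsion POINT of one real cubic);
member `true` is `GenusTwoNeronSector` (genus 2: one real torsion PAIR of one real quintic `M`-curve). -/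
def NeronTorsionGenusTwoMember : Bool → Prop
  | false => NeronTorsionPrimitiveChain
  | true => GenusTwoNeronSector

/-- **THE RUNG `NeronTorsionGenusTwo`: both members.** -/
def NeronTorsionGenusTwo : Prop := ∀ two : Bool, NeronTorsionGenusTwoMember two

/-- **The PRIMITIVE GENUS-TWO CHAIN** (the `∃`-form of member `true`, shaped like the floor): same data, tie and pinned
cells, and the conclusion that for SOME integer `c` and SOME real algebraic `B > 1` the element lies in `KZ.relations`.
It implies the tied member by soundness + the landed log calculus (`genusTwoSector_of_primitiveChain`).
[cite: KontsevichZagier2001, §1.2] -/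
def GenusTwoPrimitiveChain : Prop :=
  ∀ (e₁ e₂ e₃ e₄ e₅ l₄ l₃ l₂ l₁ l₀ x₁ x₂ ε : ℝ) (M : ℕ) (n₁ n₂ : ℤ) (f : ℝ → ℝ),
    (∀ x, f x = 4 * x ^ 5 + l₄ * x ^ 4 + l₃ * x ^ 3 + l₂ * x ^ 2 + l₁ * x + l₀) →
    (∀ x, f x = 4 * (x - e₁) * (x - e₂) * (x - e₃) * (x - e₄) * (x - e₅)) →
    e₅ < e₄ →
    e₄ < e₃ →
    e₃ < e₂ →
    e₂ < e₁ →
    e₁ < x₁ →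
    (ε = 1 ∨ ε = -1) →
    e₃ < x₂ →
    x₂ < e₂ →
    0 < M →
    2 * (M : ℝ) * (ε * (∫ x in Set.Ioo e₁ x₁, (Real.sqrt (f x))⁻¹) + ∫ x in Set.Ioo e₃ x₂, (Real.sqrt (f x))⁻¹) =
      n₁ * (2 * ∫ x in Set.Ioo e₅ e₄, (Real.sqrt (f x))⁻¹) + n₂ * (2 * ∫ x in Set.Ioo e₃ e₂, (Real.sqrt (f x))⁻¹) →
    2 * (M : ℝ) * (ε * (∫ x in Set.Ioo e₁ x₁, x / Real.sqrt (f x)) + ∫ x in Set.Ioo e₃ x₂, x / Real.sqrt (f x)) =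
      n₁ * (2 * ∫ x in Set.Ioo e₅ e₄, x / Real.sqrt (f x)) + n₂ * (2 * ∫ x in Set.Ioo e₃ e₂, x / Real.sqrt (f x)) →
    ∀ (rI₁ rI₂ rX R₁₁ R₁₂ R₂₁ R₂₂ : KZ.IntegralRep 2) (rJ : KZ.IntegralRep 1),
    rI₁.domain = {z | e₁ < z 1 ∧ z 1 < z 0 ∧ z 0 < x₁} →
    Set.EqOn rI₁.integrand (bakerKernel f l₄ l₃) rI₁.domain →
    rI₂.domain = {z | e₃ < z 1 ∧ z 1 < z 0 ∧ z 0 < x₂} →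
    Set.EqOn rI₂.integrand (bakerKernel f l₄ l₃) rI₂.domain →
    rX.domain = {z | e₁ < z 1 ∧ z 1 < x₁ ∧ e₃ < z 0 ∧ z 0 < x₂} →
    Set.EqOn rX.integrand (fun z => ε * bakerKernel f l₄ l₃ z) rX.domain →
    rJ.domain = {t | e₃ < t 0 ∧ t 0 < x₂} →
    Set.EqOn rJ.integrand
      (fun t => (ε * Real.sqrt (f x₁) - Real.sqrt (f (t 0))) / (2 * (x₁ - t 0) * Real.sqrt (f (t 0)))) rJ.domain →
    R₁₁.domain = {z | e₅ < z 0 ∧ z 0 < e₄ ∧ e₅ < z 1 ∧ z 1 < e₄} →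
    Set.EqOn R₁₁.integrand (fun z => 4 * bakerKernel f l₄ l₃ z) R₁₁.domain →
    R₁₂.domain = {z | e₅ < z 0 ∧ z 0 < e₄ ∧ e₃ < z 1 ∧ z 1 < e₂} →
    Set.EqOn R₁₂.integrand (fun z => 4 * bakerKernel f l₄ l₃ z) R₁₂.domain →
    R₂₁.domain = {z | e₃ < z 0 ∧ z 0 < e₂ ∧ e₅ < z 1 ∧ z 1 < e₄} →
    Set.EqOn R₂₁.integrand (fun z => 4 * bakerKernel f l₄ l₃ z) R₂₁.domain →
    R₂₂.domain = {z | e₃ < z 0 ∧ z 0 < e₂ ∧ e₃ < z 1 ∧ z 1 < e₂} →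
    Set.EqOn R₂₂.integrand (fun z => 4 * bakerKernel f l₄ l₃ z) R₂₂.domain →
    ∃ (c : ℤ) (B : ℝ) (rB : KZ.IntegralRep 1), 1 < B ∧ IsAlgebraic ℚ B ∧ rB.domain = {t | 1 < t 0 ∧ t 0 < B} ∧
      Set.EqOn rB.integrand (fun t => (t 0)⁻¹) rB.domain ∧
      (8 * (M : ℤ) ^ 2) • (KZ.of rI₁ + KZ.of rI₂ + KZ.of rX - KZ.of rJ) -
        ((n₁ ^ 2) • KZ.of R₁₁ + (n₁ * n₂) • KZ.of R₁₂ + (n₂ * n₁) • KZ.of R₂₁ + (n₂ ^ 2) • KZ.of R₂₂) -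
      c • KZ.of rB ∈ KZ.relations

/-- **Stub A statement (L/XL, classical): the ABEL–JACOBI PAIR CERTIFICATE.**  The torsion tie (both holomorphic
displacements of `[P₁ + P₂ − E₁ − E₃]`, times `2M`, are integer combinations of the real periods) makes the divisor
`2M(P₁ + P₂ − E₁ − E₃)` principal (Abel–Jacobi on `Pic⁰` of the genus-2 curve, [cite: Lang1983, Ch. 13];
[cite: SilvermanATAEC1994, III §3] for the genus-1 shape the floor uses via `addOrderOf`), i.e. there is a REAL function
`φ = P(x) + Q(x)·y ∈ L(4M·∞)` with `div φ = 2M·P₁ + 2M·P₂ − 4M·∞`: the norm identity `P² − Q²f = κ·((x−x₁)(x−x₂))^(2M)`,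
vanishing on the sheets of `P₁ = (x₁, ε√f(x₁))`, `P₂ = (x₂, √f(x₂))` and NON-vanishing on the conjugate sheets.  This is the
genus-2 replacement of the floor's `addOrderOf … = N` ↦ division-polynomial step; no group law on the Jacobian is typed. -/
def AbelJacobiPairCertificate : Prop :=
  ∀ (e₁ e₂ e₃ e₄ e₅ l₄ l₃ l₂ l₁ l₀ x₁ x₂ ε : ℝ) (M : ℕ) (n₁ n₂ : ℤ) (f : ℝ → ℝ),
    (∀ x, f x = 4 * x ^ 5 + l₄ * x ^ 4 + l₃ * x ^ 3 + l₂ * x ^ 2 + l₁ * x + l₀) →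
    (∀ x, f x = 4 * (x - e₁) * (x - e₂) * (x - e₃) * (x - e₄) * (x - e₅)) →
    e₅ < e₄ →
    e₄ < e₃ →
    e₃ < e₂ →
    e₂ < e₁ →
    e₁ < x₁ →
    (ε = 1 ∨ ε = -1) →
    e₃ < x₂ →
    x₂ < e₂ →
    0 < M →
    2 * (M : ℝ) * (ε * (∫ x in Set.Ioo e₁ x₁, (Real.sqrt (f x))⁻¹) + ∫ x in Set.Ioo e₃ x₂, (Real.sqrt (f x))⁻¹) =
      n₁ * (2 * ∫ x in Set.Ioo e₅ e₄, (Real.sqrt (f x))⁻¹) + n₂ * (2 * ∫ x in Set.Ioo e₃ e₂, (Real.sqrt (f x))⁻¹) →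
    2 * (M : ℝ) * (ε * (∫ x in Set.Ioo e₁ x₁, x / Real.sqrt (f x)) + ∫ x in Set.Ioo e₃ x₂, x / Real.sqrt (f x)) =
      n₁ * (2 * ∫ x in Set.Ioo e₅ e₄, x / Real.sqrt (f x)) + n₂ * (2 * ∫ x in Set.Ioo e₃ e₂, x / Real.sqrt (f x)) →
    ∃ (P Q : Polynomial ℝ) (κ : ℝ), κ ≠ 0 ∧
      (∀ x, (P.eval x) ^ 2 - (Q.eval x) ^ 2 * f x = κ * ((x - x₁) * (x - x₂)) ^ (2 * M)) ∧
      P.eval x₁ + Q.eval x₁ * (ε * Real.sqrt (f x₁)) = 0 ∧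
      P.eval x₂ + Q.eval x₂ * Real.sqrt (f x₂) = 0 ∧
      P.eval x₁ - Q.eval x₁ * (ε * Real.sqrt (f x₁)) ≠ 0 ∧
      P.eval x₂ - Q.eval x₂ * Real.sqrt (f x₂) ≠ 0

/-- **Stub B statement (XL, THE REAL STEP): the GENUS-TWO PAIR CHAIN.**  Given the data, the tie AND an Abel–Jacobi
certificate `φ = P + Q·y` (stub A's conclusion as hypotheses), the pinned cells admit a finite chain of KZ moves
(rules 1–3: Fubini/Newton–Leibniz in the outer variable `z₀` of the Baker triangles against the algebraic primitive
`d log φ`-type third-kind function `(y + y₁)/(2(x − x₁)y)` [Baker's `Ω(x,z)`, Buchstaber–Enolskiĭ–Leĭkin 1997 §2.1],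
dissection of the cross rectangle, and the genus-2 Legendre/Riemann bilinear relation for the period rectangles `R_ab`)
ending in `c•[1<t<B, dt/t]`.  Genus-2 analogue of the floor's stub chain (`stub_hChain` = translation calculus on ONE
cubic); the new difficulty: torsion translations act on `Jac`, not on the curve, so the chain must run through
`Sym²` (pairs) — the certificate `φ` is what replaces the floor's `x(u + u_P)` substitution. [cite: KontsevichZagier2001, §1.2] -/
def GenusTwoPairChain : Prop :=
  ∀ (e₁ e₂ e₃ e₄ e₅ l₄ l₃ l₂ l₁ l₀ x₁ x₂ ε : ℝ) (M : ℕ) (n₁ n₂ : ℤ) (f : ℝ → ℝ),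
    (∀ x, f x = 4 * x ^ 5 + l₄ * x ^ 4 + l₃ * x ^ 3 + l₂ * x ^ 2 + l₁ * x + l₀) →
    (∀ x, f x = 4 * (x - e₁) * (x - e₂) * (x - e₃) * (x - e₄) * (x - e₅)) →
    e₅ < e₄ →
    e₄ < e₃ →
    e₃ < e₂ →
    e₂ < e₁ →
    e₁ < x₁ →
    (ε = 1 ∨ ε = -1) →
    e₃ < x₂ →
    x₂ < e₂ →
    0 < M →
    2 * (M : ℝ) * (ε * (∫ x in Set.Ioo e₁ x₁, (Real.sqrt (f x))⁻¹) + ∫ x in Set.Ioo e₃ x₂, (Real.sqrt (f x))⁻¹) =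
      n₁ * (2 * ∫ x in Set.Ioo e₅ e₄, (Real.sqrt (f x))⁻¹) + n₂ * (2 * ∫ x in Set.Ioo e₃ e₂, (Real.sqrt (f x))⁻¹) →
    2 * (M : ℝ) * (ε * (∫ x in Set.Ioo e₁ x₁, x / Real.sqrt (f x)) + ∫ x in Set.Ioo e₃ x₂, x / Real.sqrt (f x)) =
      n₁ * (2 * ∫ x in Set.Ioo e₅ e₄, x / Real.sqrt (f x)) + n₂ * (2 * ∫ x in Set.Ioo e₃ e₂, x / Real.sqrt (f x)) →
    ∀ (P Q : Polynomial ℝ) (κ : ℝ),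
    κ ≠ 0 →
    (∀ x, (P.eval x) ^ 2 - (Q.eval x) ^ 2 * f x = κ * ((x - x₁) * (x - x₂)) ^ (2 * M)) →
    P.eval x₁ + Q.eval x₁ * (ε * Real.sqrt (f x₁)) = 0 →
    P.eval x₂ + Q.eval x₂ * Real.sqrt (f x₂) = 0 →
    P.eval x₁ - Q.eval x₁ * (ε * Real.sqrt (f x₁)) ≠ 0 →
    P.eval x₂ - Q.eval x₂ * Real.sqrt (f x₂) ≠ 0 →
    ∀ (rI₁ rI₂ rX R₁₁ R₁₂ R₂₁ R₂₂ : KZ.IntegralRep 2) (rJ : KZ.IntegralRep 1),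
    rI₁.domain = {z | e₁ < z 1 ∧ z 1 < z 0 ∧ z 0 < x₁} →
    Set.EqOn rI₁.integrand (bakerKernel f l₄ l₃) rI₁.domain →
    rI₂.domain = {z | e₃ < z 1 ∧ z 1 < z 0 ∧ z 0 < x₂} →
    Set.EqOn rI₂.integrand (bakerKernel f l₄ l₃) rI₂.domain →
    rX.domain = {z | e₁ < z 1 ∧ z 1 < x₁ ∧ e₃ < z 0 ∧ z 0 < x₂} →
    Set.EqOn rX.integrand (fun z => ε * bakerKernel f l₄ l₃ z) rX.domain →
    rJ.domain = {t | e₃ < t 0 ∧ t 0 < x₂} →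
    Set.EqOn rJ.integrand
      (fun t => (ε * Real.sqrt (f x₁) - Real.sqrt (f (t 0))) / (2 * (x₁ - t 0) * Real.sqrt (f (t 0)))) rJ.domain →
    R₁₁.domain = {z | e₅ < z 0 ∧ z 0 < e₄ ∧ e₅ < z 1 ∧ z 1 < e₄} →
    Set.EqOn R₁₁.integrand (fun z => 4 * bakerKernel f l₄ l₃ z) R₁₁.domain →
    R₁₂.domain = {z | e₅ < z 0 ∧ z 0 < e₄ ∧ e₃ < z 1 ∧ z 1 < e₂} →
    Set.EqOn R₁₂.integrand (fun z => 4 * bakerKernel f l₄ l₃ z) R₁₂.domain →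
    R₂₁.domain = {z | e₃ < z 0 ∧ z 0 < e₂ ∧ e₅ < z 1 ∧ z 1 < e₄} →
    Set.EqOn R₂₁.integrand (fun z => 4 * bakerKernel f l₄ l₃ z) R₂₁.domain →
    R₂₂.domain = {z | e₃ < z 0 ∧ z 0 < e₂ ∧ e₃ < z 1 ∧ z 1 < e₂} →
    Set.EqOn R₂₂.integrand (fun z => 4 * bakerKernel f l₄ l₃ z) R₂₂.domain →
    ∃ (c : ℤ) (B : ℝ) (rB : KZ.IntegralRep 1), 1 < B ∧ IsAlgebraic ℚ B ∧ rB.domain = {t | 1 < t 0 ∧ t 0 < B} ∧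
      Set.EqOn rB.integrand (fun t => (t 0)⁻¹) rB.domain ∧
      (8 * (M : ℤ) ^ 2) • (KZ.of rI₁ + KZ.of rI₂ + KZ.of rX - KZ.of rJ) -
        ((n₁ ^ 2) • KZ.of R₁₁ + (n₁ * n₂) • KZ.of R₁₂ + (n₂ * n₁) • KZ.of R₂₁ + (n₂ ^ 2) • KZ.of R₂₂) -
      c • KZ.of rB ∈ KZ.relations

/-- The identity-component tied set `T` of the crux `TorsionSectorComplete` (copied verbatim). -/
def TorsionTied : Set Literature.NumberTheory.Transcendental.KZ.FormalRep := {d : Literature.NumberTheory.Transcendental.KZ.FormalRep | ∃ (g₂ g₃ e₁ xP yP α : ℝ) (N a : ℕ) (M k m : ℤ) (f : ℝ → ℝ) (rI rP : Literature.NumberTheory.Transcendental.KZ.IntegralRep 2) (rL : Literature.NumberTheory.Transcendental.KZ.IntegralRep 1), (∀ x, f x = 4 * x ^ 3 - g₂ * x - g₃) ∧ g₂ ^ 3 - 27 * g₃ ^ 2 ≠ 0 ∧ f e₁ = 0 ∧ 0 < e₁ ∧ (∀ x, e₁ < x → 0 < f x) ∧ e₁ < xP ∧ yP ^ 2 = f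 xP ∧ 3 ≤ N ∧ 0 < a ∧ 2 * a < N ∧ 4 * (N : ℤ) ^ 2 * k = M * ((N : ℤ) - 2 * (a : ℤ)) ^ 2 ∧ (∀ hns : (⟨0, 0, 0, -g₂ / 4, -g₃ / 4⟩ : WeierstrassCurve ℝ).toAffine.Nonsingular xP (yP / 2), addOrderOf (WeierstrassCurve.Affine.Point.some xP (yP / 2) hns) = N) ∧ (N : ℝ) * (∫ x in Set.Ioi xP, (Real.sqrt (f x))⁻¹) = a * (2 * ∫ x in Set.Ioi e₁, (Real.sqrt (f x))⁻¹) ∧ 1 < α ∧ rI.domain = {z | e₁ < z 1 ∧ z 1 < z 0 ∧ z 0 < xP} ∧ Set.EqOn rI.integrand (fun z => z 1 / (Real.sqrt (f (z 1)) * Real.sqrt (f (z 0)))) rI.domain ∧ rP.domain = {z | e₁ < z 0 ∧ e₁ < z 1} ∧ Set.EqOn rP.integrand (fun z => (Real.sqrt (f (z 0)))⁻¹ * ((g₂ * z 1 + 2 * g₃) / (2 * (z 1) ^ 2 * Real.sqrt (f (z 1))))) rP.domain ∧ rL.domain = {t | 1 < t 0 ∧ t 0 < α} ∧ Set.EqOn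 rL.integrand (fun t => (t 0)⁻¹) rL.domain ∧ (M : ℝ) * rI.value + k * rP.value = m * rL.value ∧ d = M • Literature.NumberTheory.Transcendental.KZ.of rI + k • Literature.NumberTheory.Transcendental.KZ.of rP - m • Literature.NumberTheory.Transcendental.KZ.of rL}

/-- The tied GENUS-TWO set `T₂`: the elements of member `true`, with their hypotheses (incl. the value hypothesis). -/
def GenusTwoTied : Set KZ.FormalRep :=
  {d | ∃ (e₁ e₂ e₃ e₄ e₅ l₄ l₃ l₂ l₁ l₀ x₁ x₂ ε B : ℝ) (M : ℕ) (n₁ n₂ c : ℤ) (f : ℝ → ℝ)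
    (rI₁ rI₂ rX R₁₁ R₁₂ R₂₁ R₂₂ : KZ.IntegralRep 2) (rJ rB : KZ.IntegralRep 1),
    (∀ x, f x = 4 * x ^ 5 + l₄ * x ^ 4 + l₃ * x ^ 3 + l₂ * x ^ 2 + l₁ * x + l₀) ∧
    (∀ x, f x = 4 * (x - e₁) * (x - e₂) * (x - e₃) * (x - e₄) * (x - e₅)) ∧
    e₅ < e₄ ∧
    e₄ < e₃ ∧
    e₃ < e₂ ∧
    e₂ < e₁ ∧
    e₁ < x₁ ∧
    (ε = 1 ∨ ε = -1) ∧
    e₃ < x₂ ∧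
    x₂ < e₂ ∧
    0 < M ∧
    2 * (M : ℝ) * (ε * (∫ x in Set.Ioo e₁ x₁, (Real.sqrt (f x))⁻¹) + ∫ x in Set.Ioo e₃ x₂, (Real.sqrt (f x))⁻¹) =
      n₁ * (2 * ∫ x in Set.Ioo e₅ e₄, (Real.sqrt (f x))⁻¹) + n₂ * (2 * ∫ x in Set.Ioo e₃ e₂, (Real.sqrt (f x))⁻¹) ∧
    2 * (M : ℝ) * (ε * (∫ x in Set.Ioo e₁ x₁, x / Real.sqrt (f x)) + ∫ x in Set.Ioo e₃ x₂, x / Real.sqrt (f x)) =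
      n₁ * (2 * ∫ x in Set.Ioo e₅ e₄, x / Real.sqrt (f x)) + n₂ * (2 * ∫ x in Set.Ioo e₃ e₂, x / Real.sqrt (f x)) ∧
    1 < B ∧
    rI₁.domain = {z | e₁ < z 1 ∧ z 1 < z 0 ∧ z 0 < x₁} ∧
    Set.EqOn rI₁.integrand (bakerKernel f l₄ l₃) rI₁.domain ∧
    rI₂.domain = {z | e₃ < z 1 ∧ z 1 < z 0 ∧ z 0 < x₂} ∧
    Set.EqOn rI₂.integrand (bakerKernel f l₄ l₃) rI₂.domain ∧
    rX.domain = {z | e₁ < z 1 ∧ z 1 < x₁ ∧ e₃ < z 0 ∧ z 0 < x₂} ∧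
    Set.EqOn rX.integrand (fun z => ε * bakerKernel f l₄ l₃ z) rX.domain ∧
    rJ.domain = {t | e₃ < t 0 ∧ t 0 < x₂} ∧
    Set.EqOn rJ.integrand
      (fun t => (ε * Real.sqrt (f x₁) - Real.sqrt (f (t 0))) / (2 * (x₁ - t 0) * Real.sqrt (f (t 0)))) rJ.domain ∧
    R₁₁.domain = {z | e₅ < z 0 ∧ z 0 < e₄ ∧ e₅ < z 1 ∧ z 1 < e₄} ∧
    Set.EqOn R₁₁.integrand (fun z => 4 * bakerKernel f l₄ l₃ z) R₁₁.domain ∧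
    R₁₂.domain = {z | e₅ < z 0 ∧ z 0 < e₄ ∧ e₃ < z 1 ∧ z 1 < e₂} ∧
    Set.EqOn R₁₂.integrand (fun z => 4 * bakerKernel f l₄ l₃ z) R₁₂.domain ∧
    R₂₁.domain = {z | e₃ < z 0 ∧ z 0 < e₂ ∧ e₅ < z 1 ∧ z 1 < e₄} ∧
    Set.EqOn R₂₁.integrand (fun z => 4 * bakerKernel f l₄ l₃ z) R₂₁.domain ∧
    R₂₂.domain = {z | e₃ < z 0 ∧ z 0 < e₂ ∧ e₃ < z 1 ∧ z 1 < e₂} ∧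
    Set.EqOn R₂₂.integrand (fun z => 4 * bakerKernel f l₄ l₃ z) R₂₂.domain ∧
    rB.domain = {t | 1 < t 0 ∧ t 0 < B} ∧
    Set.EqOn rB.integrand (fun t => (t 0)⁻¹) rB.domain ∧
    8 * (M : ℝ) ^ 2 * (rI₁.value + rI₂.value + rX.value - rJ.value) -
        ((n₁ : ℝ) ^ 2 * R₁₁.value + n₁ * n₂ * R₁₂.value + n₂ * n₁ * R₂₁.value + (n₂ : ℝ) ^ 2 * R₂₂.value) =
      c * rB.value ∧
    d = (8 * (M : ℤ) ^ 2) • (KZ.of rI₁ + KZ.of rI₂ + KZ.of rX - KZ.of rJ) -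
        ((n₁ ^ 2) • KZ.of R₁₁ + (n₁ * n₂) • KZ.of R₁₂ + (n₂ * n₁) • KZ.of R₂₁ + (n₂ ^ 2) • KZ.of R₂₂) -
      c • KZ.of rB}

/-- **Stub D statement (residual, conjecture-grade): completeness off the sector enlarged by the genus-two elements.**
Two rational-shape representations with equal values differ by an element of `relations ⊔ closure (T ∪ T₂)`.  Between
`KZKernelConjecture` (`relations` alone) and the crux (`relations ⊔ closure T`); WEAKER than the crux
(`genusTwoSectorComplete_of_torsionSectorComplete`). [cite: KontsevichZagier2001, §1.2 Conjecture 1] -/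
def GenusTwoSectorComplete : Prop := ∀ ⦃n m : ℕ⦄ (r : KZ.IntegralRep n) (r' : KZ.IntegralRep m),
  r.IsRational → r'.IsRational → r.value = r'.value → KZ.of r - KZ.of r' ∈ KZ.relations ⊔ AddSubgroup.closure (TorsionTied ∪ GenusTwoTied)

/-! ### Registered stubs -/

/-- **Stub A (L/XL, classical Abel–Jacobi).** `AbelJacobiPairCertificate`. -/
theorem stub_abelJacobiPairCertificate : AbelJacobiPairCertificate := by
  sorry

/-- **Stub B (XL, load-bearing, the new move).** `GenusTwoPairChain`. -/
theorem stub_genusTwoPairChain : GenusTwoPairChain := by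
  sorry

/-- **Stub D (residual, conjecture-grade).** `GenusTwoSectorComplete`. -/
theorem stub_genusTwoSectorComplete : GenusTwoSectorComplete := by
  sorry

/-! ### Proved infrastructure (no `sorry` below this line) -/

/-- The crux unfolds to completeness relative to `relations ⊔ closure T`. -/
theorem torsionSectorComplete_iff :
    TorsionSectorComplete ↔ ∀ ⦃n m : ℕ⦄ (r : KZ.IntegralRep n) (r' : KZ.IntegralRep m), r.IsRational → r'.IsRational →
      r.value = r'.value → KZ.of r - KZ.of r' ∈ KZ.relations ⊔ AddSubgroup.closure TorsionTied :=
  Iff.rfl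

/-- Member `false` is the floor, definitionally. -/
theorem member_false_iff : NeronTorsionGenusTwoMember false ↔ NeronTorsionPrimitiveChain := Iff.rfl

/-- Member `true` is the genus-two sector statement, definitionally. -/
theorem member_true_iff : NeronTorsionGenusTwoMember true ↔ GenusTwoNeronSector := Iff.rfl

/-- The rung is the floor plus the new member. -/
theorem neronTorsionGenusTwo_iff : NeronTorsionGenusTwo ↔ NeronTorsionPrimitiveChain ∧ GenusTwoNeronSector := by
  constructor
  · exact fun h => ⟨h false, h true⟩
  · rintro ⟨h₀, h₁⟩ (_ | _)
    · exact h₀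
    · exact h₁

/-- **WITNESS: the rung at the floor.** Member `false` is the CLOSED seed (`Cruxes.NeronTorsionSector.Translation.stub_assembly`,
route link `NeronTorsionPrimitiveChain_holds`). -/
theorem rung_false : NeronTorsionGenusTwoMember false := NeronTorsionPrimitiveChain_holds

/-- **The primitive genus-two chain from stubs A and B** (pure logic: A's certificate feeds B). -/
theorem genusTwoPrimitiveChain_of (hA : AbelJacobiPairCertificate) (hB : GenusTwoPairChain) : GenusTwoPrimitiveChain := by
  intro e₁ e₂ e₃ e₄ e₅ l₄ l₃ l₂ l₁ l₀ x₁ x₂ ε M n₁ n₂ f hf hfe h54 h43 h32 h21 hx₁ hε hx₂ hx₂' hM ht₁ ht₂ rI₁ rI₂ rX R₁₁ R₁₂ R₂₁ R₂₂ rJ hdI₁ hiI₁ hdI₂ hiI₂ hdX hiX hdJ hiJ hd11 hi11 hd12 hi12 hd21 hi21 hd22 hi22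
  obtain ⟨P, Q, κ, hκ, hN, hz₁, hz₂, hn₁, hn₂⟩ := hA e₁ e₂ e₃ e₄ e₅ l₄ l₃ l₂ l₁ l₀ x₁ x₂ ε M n₁ n₂ f hf hfe h54 h43 h32 h21 hx₁ hε hx₂ hx₂' hM ht₁ ht₂
  exact hB e₁ e₂ e₃ e₄ e₅ l₄ l₃ l₂ l₁ l₀ x₁ x₂ ε M n₁ n₂ f hf hfe h54 h43 h32 h21 hx₁ hε hx₂ hx₂' hM ht₁ ht₂ P Q κ hκ hN hz₁ hz₂ hn₁ hn₂ rI₁ rI₂ rX R₁₁ R₁₂ R₂₁ R₂₂ rJ hdI₁ hiI₁ hdI₂ hiI₂ hdX hiX hdJ hiJ hd11 hi11 hd12 hi12 hd21 hi21 hd22 hi22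

/-- **Bookkeeping: the primitive chain gives the tied member.**  Soundness of `relations` (`KZ.relations_le_ker_eval_holds`)
and the value hypothesis give `c₀ log B₀ = c log B` between logarithms of real algebraic numbers (`B` algebraic because
`(1, B)` is `ℚ`-semialgebraic), realised by moves by the landed log calculus (`interval_log_relation_mem_relations`); the
tied element is the primitive one plus `c₀•[rB₀] − c•[rB]`. [cite: KontsevichZagier2001, §1.2] -/
theorem genusTwoSector_of_primitiveChain (hPC : GenusTwoPrimitiveChain) : GenusTwoNeronSector := by
  intro e₁ e₂ e₃ e₄ e₅ l₄ l₃ l₂ l₁ l₀ x₁ x₂ ε B M n₁ n₂ c f hf hfe h54 h43 h32 h21 hx₁ hε hx₂ hx₂' hM ht₁ ht₂ hB rI₁ rI₂ rX R₁₁ R₁₂ R₂₁ R₂₂ rJ rB hdI₁ hiI₁ hdI₂ hiI₂ hdX hiX hdJ hiJ hd11 hi11 hd12 hi12 hd21 hi21 hd22 hi22 hdB hiB hval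
  obtain ⟨c₀, B₀, rB₀, hB₀, hB₀alg, hdB₀, hiB₀, hprim⟩ := hPC e₁ e₂ e₃ e₄ e₅ l₄ l₃ l₂ l₁ l₀ x₁ x₂ ε M n₁ n₂ f hf hfe h54 h43 h32 h21 hx₁ hε hx₂ hx₂' hM ht₁ ht₂ rI₁ rI₂ rX R₁₁ R₁₂ R₂₁ R₂₂ rJ hdI₁ hiI₁ hdI₂ hiI₂ hdX hiX hdJ hiJ hd11 hi11 hd12 hi12 hd21 hi21 hd22 hi22
  have hvB₀ : rB₀.value = Real.log B₀ := logRep_value hB₀.le rB₀ hdB₀ hiB₀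
  have hvB : rB.value = Real.log B := logRep_value hB.le rB hdB hiB
  have hBalg : IsAlgebraic ℚ B := isAlgebraic_of_logRep hB rB hdB
  have h0 : 8 * (M : ℝ) ^ 2 * (rI₁.value + rI₂.value + rX.value - rJ.value) -
      ((n₁ : ℝ) ^ 2 * R₁₁.value + n₁ * n₂ * R₁₂.value + n₂ * n₁ * R₂₁.value + (n₂ : ℝ) ^ 2 * R₂₂.value) -
        c₀ * Real.log B₀ = 0 := by
    have h := KZ.relations_le_ker_eval_holds hprim
    rw [AddMonoidHom.mem_ker] at h
    simp only [map_add, map_sub, map_zsmul, KZ.eval_of, zsmul_eq_mul, hvB₀] at h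
    push_cast at h
    linear_combination h
  have hlog : (c₀ : ℝ) * Real.log B₀ - c * Real.log B = 0 := by
    rw [hvB] at hval
    linear_combination hval - h0
  have hiB01 : Set.EqOn rB₀.integrand (fun t : Fin 1 → ℝ => 1 / t 0) rB₀.domain := fun t ht => by
    simp only [hiB₀ ht, one_div]
  have hiB1 : Set.EqOn rB.integrand (fun t : Fin 1 → ℝ => 1 / t 0) rB.domain := fun t ht => by
    simp only [hiB ht, one_div]
  have hL : c₀ • KZ.of rB₀ - c • KZ.of rB ∈ KZ.relations := by
    have h := interval_log_relation_mem_relations 2 ![1, 1] ![B₀, B] ![c₀, -c] ![rB₀, rB]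
      (fun i => by fin_cases i <;> simp)
      (fun i => by fin_cases i <;> simp [hB₀.le, hB.le])
      (fun i => by fin_cases i <;> exact isAlgebraic_one)
      (fun i => by fin_cases i <;> simp [hB₀alg, hBalg])
      (fun i => by
        fin_cases i
        · exact ⟨hdB₀, hiB01⟩
        · exact ⟨hdB, hiB1⟩)
      (by
        simp only [Fin.sum_univ_two, Matrix.cons_val_zero, Matrix.cons_val_one, div_one, Int.cast_neg]
        linear_combination hlog)
    have e : ∑ i : Fin 2, (![c₀, -c] i : ℤ) • KZ.of (![rB₀, rB] i) = c₀ • KZ.of rB₀ - c • KZ.of rB := by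
      simp only [Fin.sum_univ_two, Matrix.cons_val_zero, Matrix.cons_val_one, neg_smul]
      abel
    rw [e] at h
    exact h
  have e : (8 * (M : ℤ) ^ 2) • (KZ.of rI₁ + KZ.of rI₂ + KZ.of rX - KZ.of rJ) -
        ((n₁ ^ 2) • KZ.of R₁₁ + (n₁ * n₂) • KZ.of R₁₂ + (n₂ * n₁) • KZ.of R₂₁ + (n₂ ^ 2) • KZ.of R₂₂) -
      c • KZ.of rB =
      ((8 * (M : ℤ) ^ 2) • (KZ.of rI₁ + KZ.of rI₂ + KZ.of rX - KZ.of rJ) -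
        ((n₁ ^ 2) • KZ.of R₁₁ + (n₁ * n₂) • KZ.of R₁₂ + (n₂ * n₁) • KZ.of R₂₁ + (n₂ ^ 2) • KZ.of R₂₂) -
      c₀ • KZ.of rB₀) +
        (c₀ • KZ.of rB₀ - c • KZ.of rB) := by
    abel
  rw [e]
  exact KZ.relations.add_mem hprim hL

/-- **The rung from stubs A and B** (the floor is a theorem). -/
theorem NeronTorsionGenusTwo_of (hA : AbelJacobiPairCertificate) (hB : GenusTwoPairChain) : NeronTorsionGenusTwo :=
  neronTorsionGenusTwo_iff.mpr
    ⟨NeronTorsionPrimitiveChain_holds, genusTwoSector_of_primitiveChain (genusTwoPrimitiveChain_of hA hB)⟩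

/-- The genus-two member says exactly `closure T₂ ≤ KZ.relations`. [cite: KontsevichZagier2001, §1.2] -/
theorem closure_genusTwoTied_le_relations (h : GenusTwoNeronSector) : AddSubgroup.closure GenusTwoTied ≤ KZ.relations := by
  refine (AddSubgroup.closure_le _).mpr ?_
  rintro d ⟨e₁, e₂, e₃, e₄, e₅, l₄, l₃, l₂, l₁, l₀, x₁, x₂, ε, B, M, n₁, n₂, c, f, rI₁, rI₂, rX, R₁₁, R₁₂, R₂₁, R₂₂, rJ, rB, hf, hfe, h54, h43, h32, h21, hx₁, hε, hx₂, hx₂', hM, ht₁, ht₂, hB, hdI₁, hiI₁, hdI₂, hiI₂, hdX, hiX, hdJ, hiJ, hd11, hi11, hd12, hi12, hd21, hi21, hd22, hi22, hdB, hiB,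
    hval, rfl⟩
  exact h e₁ e₂ e₃ e₄ e₅ l₄ l₃ l₂ l₁ l₀ x₁ x₂ ε B M n₁ n₂ c f hf hfe h54 h43 h32 h21 hx₁ hε hx₂ hx₂' hM ht₁ ht₂ hB rI₁ rI₂ rX R₁₁ R₁₂ R₂₁ R₂₂ rJ rB hdI₁ hiI₁ hdI₂ hiI₂ hdX hiX hdJ hiJ hd11 hi11 hd12 hi12 hd21 hi21 hd22 hi22 hdB hiB
    hval

/-- The identity-component sector (the route's CLOSED sibling crux `NeronTorsionSector`, landed as
`NeronTorsionSector_of`) says exactly `closure T ≤ KZ.relations`. [cite: KontsevichZagier2001, §1.2] -/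
theorem closure_torsionTied_le_relations : AddSubgroup.closure TorsionTied ≤ KZ.relations := by
  have h : NeronTorsionSector := NeronTorsionSector_of
  refine (AddSubgroup.closure_le _).mpr ?_
  rintro d ⟨g₂, g₃, e₁, xP, yP, α, N, a, M, k, m', f, rI, rP, rL, hf, hdisc, he, he0, hpos, hx, hy, hN, ha,
    ha', htie, hord, htor, hα, hdI, hiI, hdP, hiP, hdL, hiL, hval, rfl⟩
  exact h g₂ g₃ e₁ xP yP α N a M k m' f hf hdisc he he0 hpos hx hy hN ha ha' htie hord htor hα rI rP rL hdI hiI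
    hdP hiP hdL hiL hval

/-- **ON-PATH, new member:** Conjecture 1 in kernel form gives the tied genus-two statement — the element evaluates
to the value hypothesis. [cite: KontsevichZagier2001, §1.2] -/
@[simp] theorem genusTwoSector_of_kontsevichZagierPeriods (h : _root_.KontsevichZagierPeriods) :
    GenusTwoNeronSector := by
  have hK : KZKernelConjecture := kzKernelConjecture_iff_isRational.mpr h
  intro e₁ e₂ e₃ e₄ e₅ l₄ l₃ l₂ l₁ l₀ x₁ x₂ ε B M n₁ n₂ c f _ _ _ _ _ _ _ _ _ _ _ _ _ _ rI₁ rI₂ rX R₁₁ R₁₂ R₂₁ R₂₂ rJ rB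
    _ _ _ _ _ _ _ _ _ _ _ _ _ _ _ _ _ _ hval
  apply hK
  simp only [map_sub, map_add, map_zsmul, KZ.eval_of, zsmul_eq_mul]
  push_cast
  linear_combination hval

/-- **ON-PATH LEMMA: the summit implies the rung** (member `false` is a theorem outright). -/
@[simp] theorem neronTorsionGenusTwo_of_kontsevichZagierPeriods (h : _root_.KontsevichZagierPeriods) :
    NeronTorsionGenusTwo :=
  neronTorsionGenusTwo_iff.mpr ⟨NeronTorsionPrimitiveChain_holds, genusTwoSector_of_kontsevichZagierPeriods h⟩

/-- The same, as an implication (the literal shape `S → Rung` of the forward probe). -/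
theorem onPath : _root_.KontsevichZagierPeriods → NeronTorsionGenusTwo :=
  neronTorsionGenusTwo_of_kontsevichZagierPeriods

/-- The residual is a consequence of the crux (hence of the summit): `closure T ≤ closure (T ∪ T₂)`.
(Informational: stub D is WEAKER than the crux as typed.) [folklore] -/
theorem genusTwoSectorComplete_of_torsionSectorComplete (h : TorsionSectorComplete) : GenusTwoSectorComplete := by
  intro n m r r' hr hr' hv
  have hmono : KZ.relations ⊔ AddSubgroup.closure TorsionTied ≤
      KZ.relations ⊔ AddSubgroup.closure (TorsionTied ∪ GenusTwoTied) :=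
    sup_le_sup_left (AddSubgroup.closure_mono Set.subset_union_left) _
  exact hmono (torsionSectorComplete_iff.mp h r r' hr hr' hv)

/-- The rung specialises to the floor (member `false`); `@[simp]` so that the tribunal's forward probe
`Rung → floor` closes (`intro h; aesop`). -/
@[simp] theorem floor_of_rung (h : NeronTorsionGenusTwo) : NeronTorsionPrimitiveChain := h false


/-- The rung specialises to the floor AS A TYPE: the conclusion is the floor theorem's statement verbatim (the type of
`Cruxes.NeronTorsionSector.Translation.stub_assembly`), so that the forward probe `Rung → ⟨type of the floor decl⟩`
closes by `simp`/`exact?`. -/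
@[simp] theorem floorStatement_of_rung (h : NeronTorsionGenusTwo) :
    ∀ (g₂ g₃ e₁ xP yP : ℝ) (N a p q : ℕ) (f : ℝ → ℝ), (∀ x, f x = 4 * x ^ 3 - g₂ * x - g₃) → g₂ ^ 3 - 27 * g₃ ^ 2 ≠ 0 → f e₁ = 0 → 0 < e₁ → (∀ x, e₁ < x → 0 < f x) → e₁ < xP → yP ^ 2 = f xP → 3 ≤ N → 0 < a → 2 * a < N → (∀ hns : (⟨0, 0, 0, -g₂ / 4, -g₃ / 4⟩ : WeierstrassCurve ℝ).toAffine.Nonsingular xP (yP / 2), addOrderOf (WeierstrassCurve.Affine.Point.some xP (yP / 2) hns) = N) → (N : ℝ) * (∫ x in Set.Ioi xP, (Real.sqrt (f x))⁻¹) = a * (2 * ∫ x in Set.Ioi e₁, (Real.sqrt (f x))⁻¹) → Nat.Coprime p q → (q : ℤ) * ((N : ℤ) - 2 * (a : ℤ)) = (p : ℤ) * (2 * (N : ℤ)) → ∀ (rI rP : Literature.NumberTheory.Transcendental.KZ.IntegralRep 2), rI.domain = {z | e₁ < z 1 ∧ z 1 < z 0 ∧ z 0 < xP} → Set.EqOn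 rI.integrand (fun z => z 1 / (Real.sqrt (f (z 1)) * Real.sqrt (f (z 0)))) rI.domain → rP.domain = {z | e₁ < z 0 ∧ e₁ < z 1} → Set.EqOn rP.integrand (fun z => (Real.sqrt (f (z 0)))⁻¹ * ((g₂ * z 1 + 2 * g₃) / (2 * (z 1) ^ 2 * Real.sqrt (f (z 1))))) rP.domain → ∃ (c : ℤ) (B : ℝ) (rB : Literature.NumberTheory.Transcendental.KZ.IntegralRep 1), 1 < B ∧ IsAlgebraic ℚ B ∧ rB.domain = {t | 1 < t 0 ∧ t 0 < B} ∧ Set.EqOn rB.integrand (fun t => (t 0)⁻¹) rB.domain ∧ ((q : ℤ) ^ 2) • Literature.NumberTheory.Transcendental.KZ.of rI + ((p : ℤ) ^ 2) • Literature.NumberTheory.Transcendental.KZ.of rP - c • Literature.NumberTheory.Transcendental.KZ.of rB ∈ Literature.NumberTheory.Transcendental.KZ.relations :=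
  h false


/-! ### Composition: the crux BY NAME from the three stubs -/

/-- **The folding inequality (sorry-free, stubs A + B as hypotheses):** stubs A + B give the rung's new member
(`genusTwoSector_of_primitiveChain ∘ genusTwoPrimitiveChain_of`), which folds the genus-two sector into the moves
(`closure T₂ ≤ relations`), so the residual's `relations ⊔ closure (T ∪ T₂)` is `≤ relations ⊔ closure T`.
[cite: KontsevichZagier2001, §1.2] -/
theorem sup_closure_le_of_certificate_chain (hA : AbelJacobiPairCertificate) (hB : GenusTwoPairChain) :
    KZ.relations ⊔ AddSubgroup.closure (TorsionTied ∪ GenusTwoTied) ≤ KZ.relations ⊔ AddSubgroup.closure TorsionTied := by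
  have hR : GenusTwoNeronSector := genusTwoSector_of_primitiveChain (genusTwoPrimitiveChain_of hA hB)
  refine sup_le le_sup_left ((AddSubgroup.closure_le _).mpr ?_)
  rintro d (hd | hd)
  · exact AddSubgroup.mem_sup_right (AddSubgroup.subset_closure hd)
  · exact AddSubgroup.mem_sup_left (closure_genusTwoTied_le_relations hR (AddSubgroup.subset_closure hd))

/-- **`TorsionSectorComplete` BY NAME from the three registered stubs** — the ONLY theorem of this file concluding the crux;
the implication `AbelJacobiPairCertificate → GenusTwoPairChain → GenusTwoSectorComplete → TorsionSectorComplete` is the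
`suffices` step (closed term, no `sorry`); `sorry` enters only through `stub_abelJacobiPairCertificate`,
`stub_genusTwoPairChain` and `stub_genusTwoSectorComplete`. [cite: KontsevichZagier2001, §1.2] -/
theorem TorsionSectorComplete_of : TorsionSectorComplete := by
  suffices key : AbelJacobiPairCertificate → GenusTwoPairChain → GenusTwoSectorComplete → TorsionSectorComplete from
    key stub_abelJacobiPairCertificate stub_genusTwoPairChain stub_genusTwoSectorComplete
  intro hA hB hD
  rw [torsionSectorComplete_iff]
  intro n m r r' hr hr' hv
  exact sup_closure_le_of_certificate_chain hA hB (hD r r' hr hr' hv)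

end Summit.KontsevichZagierPeriods.KontsevichZagierPeriods.Cruxes.TorsionSectorComplete.NeronTorsionGenusTwo

end
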